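import Summits.Ventures.YMGap.RobustBall.RowsSU2
import HarnessLib

/-!
# Venture YMGap, track ROBUST-BALL — a non-Wilson member of the ball: the mixed fundamental–adjoint action

HONEST FRAMING. WHAT THIS IS: a venture file (cell `pub-ymgap`, track Y2 ROBUST-BALL, seat rb-p1) answering
referee test T0.2 («exhibit a member of the ball that is NOT a Wilson action at any coupling, with its
loads computed») for the `ℤ^d` ball `MemBallZd` of `MassGapOnBall.lean`: the link potential
`adjointWitness t`, which puts on (the link set of) every plaquette `p` the term `t · (Re tr U_p / N)²`
— for `SU(2)` exactly the ADJOINT-plaquette term of the Bhanot–Creutz mixed action (`(tr U)² = χ_adj + 1`),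
for `SU(N)` a class function of `U_p` that is not affine in `Re tr U_p`, hence no Wilson action at any
coupling. Its loads are computed in closed form — oscillation load `≤ 2(d-1)|t|`, cross-Lipschitz load
`≤ 16(d-1)|t|/√N`, range `1` — so it is a member of `MemBallZd (2(d-1)|t|) (16(d-1)|t|/√N) 1`
(`memBallZd_adjointWitness`), and the ball theorem yields a certified MIXED-ACTION row: for `SU(2)`,
`d = 4`, fundamental Wilson coupling `β_W = 1/8` and adjoint coefficient `|t| ≤ 1/100`, the mixed action
has exactly one DLR state on `ℤ⁴` with exponential clustering (`su2_mixedAction_massGap_1_8`).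
WHAT THIS IS NOT: not a statement about the physically normalised adjoint coupling `β_A` of the
literature beyond the dictionary `t = ` (coefficient of `(Re tr U_p/2)²`); lattice, strong coupling only;
no continuum / Millennium claim.

## References

* G. Bhanot, M. Creutz, Phys. Rev. D 24 (1981) 3212 (mixed fundamental–adjoint `SU(2)` action).
* rb-ref, `HOME/rb/referee/REFEREE-CRITERIA.md` T0.2; rb-theory DESIGN v0.2 §2.2 (w2).
-/

noncomputable section

open MeasureTheory ProbabilityTheory Real
open Literature.Probability.LatticeModels
open Literature.Probability.LatticeModels.DobrushinMetric
open Literature.MathematicalPhysics.QuantumLattice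
open Literature.MathematicalPhysics.QuantumFieldTheory hiding ZdEdge

namespace Summit.Ventures.YMGap.RobustBall

variable {d N : ℕ}

/-! ### The witness and its support family -/

open Classical in
/-- **The adjoint-plaquette witness**: on the link set `X` of a plaquette `p` the term
`t · (Re tr U_p / N)²` (normalised fundamental plaquette observable, squared), `0` on every other link
set. For `SU(2)` this is the adjoint term of the Bhanot–Creutz mixed action. (The plaquette with a given
link set is recovered by choice; only its link set matters for the loads.) -/
def adjointWitness (t : ℝ) : Potential (ZdEdge d) (Matrix.specialUnitaryGroup (Fin N) ℂ) := fun X U =>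
  if h : ∃ p : ZdPlaquette d, plaquetteEdges p = X then
    t * (plaquetteObs (fundamentalRep (Fin N)) (Classical.choose h).1 (Classical.choose h).2.1.1
      (Classical.choose h).2.1.2 U / N) ^ 2
  else 0

/-- The support family of plaquette-local potentials: the link sets of the plaquettes touching `Λ`. -/
def plaquetteSupp (Λ : Finset (ZdEdge d)) : Finset (Finset (ZdEdge d)) :=
  (plaquettesTouching Λ).image plaquetteEdges

/-! ### One-link analysis of the plaquette observable -/

/-- The normalised plaquette observable lies in `[-1, 1]` (`|Re tr U_p| ≤ N`, tree
`abs_plaquetteObs_le_holds`). -/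
theorem abs_plaquetteObs_div_le_one (hN : 1 ≤ N) (p : ZdPlaquette d)
    (U : LGConfig d (Matrix.specialUnitaryGroup (Fin N) ℂ)) :
    |plaquetteObs (fundamentalRep (Fin N)) p.1 p.2.1.1 p.2.1.2 U / N| ≤ 1 := by
  have hN0 : (0 : ℝ) < N := by exact_mod_cast hN
  rw [abs_div, abs_of_pos hN0, div_le_one hN0]
  exact abs_plaquetteObs_le_holds (fundamentalRep (Fin N)) fundamentalRep_mem_unitaryGroup _ _ _ U

/-- **The plaquette observable is `√N`-Lipschitz in each of its links** (Frobenius distance): if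
`U = V` off `y ∈ p` then `|Re tr U_p - Re tr V_p| ≤ √N ‖U_y - V_y‖_F` (the plaquette action is affine
in each link, tree `re_trace_holonomy_update`, and `g ↦ Re tr(g B)` is `‖B‖_F`-Lipschitz). -/
theorem abs_plaquetteObs_sub_le_of_eq_off {p : ZdPlaquette d} {y : ZdEdge d} (hy : y ∈ plaquetteEdges p)
    {U V : LGConfig d (Matrix.specialUnitaryGroup (Fin N) ℂ)} (hUV : ∀ z, z ≠ y → U z = V z) :
    |plaquetteObs (fundamentalRep (Fin N)) p.1 p.2.1.1 p.2.1.2 U -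
        plaquetteObs (fundamentalRep (Fin N)) p.1 p.2.1.1 p.2.1.2 V| ≤
      Real.sqrt N * suFrobDist (U y) (V y) := by
  classical
  have hV : V = Function.update U y (V y) := by
    funext z
    by_cases hz : z = y
    · subst hz; simp
    · rw [Function.update_of_ne hz]; exact (hUV z hz).symm
  have hU : U = Function.update U y (U y) := by simp
  rw [hV, hU, Function.update_idem]
  unfold plaquetteObs
  rw [re_trace_holonomy_update (fundamentalRep (Fin N)) fundamentalRep_mem_unitaryGroup hy U (U y),
    re_trace_holonomy_update (fundamentalRep (Fin N)) fundamentalRep_mem_unitaryGroup hy U (V y),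
    fundamentalRep_apply, fundamentalRep_apply, fundamentalRep_apply]
  refine (abs_re_trace_su_mul_sub_le (U y) (V y) _).trans ?_
  rw [frobNorm_su, mul_comm]
  simp

/-! ### The loads of the witness -/

/-- The witness term of a link set that is not a plaquette vanishes. -/
theorem adjointWitness_of_not (t : ℝ) {X : Finset (ZdEdge d)} (h : ¬ ∃ p : ZdPlaquette d, plaquetteEdges p = X) :
    adjointWitness (N := N) t X = fun _ => 0 := by
  funext U; simp [adjointWitness, h]

/-- Every witness term is continuous. -/
theorem continuous_adjointWitness (t : ℝ) (X : Finset (ZdEdge d)) :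
    Continuous (adjointWitness (N := N) t X) := by
  unfold adjointWitness
  split_ifs with h
  · exact continuous_const.mul
      (((continuous_plaquetteObs _ (continuous_fundamentalRep (Fin N)) _ _ _).div_const _).pow 2)
  · exact continuous_const

/-- Every witness term depends only on its own link set. -/
theorem dependsOn_adjointWitness (t : ℝ) (X : Finset (ZdEdge d)) :
    DependsOn (adjointWitness (N := N) t X) (↑X : Set (ZdEdge d)) := by
  intro U V hUV
  unfold adjointWitness
  split_ifs with h
  · have hp := Classical.choose_spec h
    rw [isCylinder_plaquetteObs (fundamentalRep (Fin N)) (Classical.choose h) fun e he =>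
      hUV e (by rw [← hp]; exact he)]
  · rfl

/-- The witness is supported by the plaquette family: an active term meeting `Λ` is the link set of a
plaquette touching `Λ`. -/
theorem isSupportedBy_adjointWitness (t : ℝ) :
    (adjointWitness (d := d) (N := N) t).IsSupportedBy plaquetteSupp := by
  intro Λ A hA hne
  by_cases h : ∃ p : ZdPlaquette d, plaquetteEdges p = A
  · obtain ⟨p, hp⟩ := h
    refine Finset.mem_image.2 ⟨p, mem_plaquettesTouching_iff.2 ?_, hp⟩
    rwa [hp]
  · exact (hne (adjointWitness_of_not t h)).elim

/-- Range `1`: the links of a plaquette through `e` are within `ℓ^∞`-distance `1` of `e`. -/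
theorem range_adjointWitness (e : ZdEdge d) (X : Finset (ZdEdge d)) (hX : X ∈ plaquetteSupp {e})
    (he : e ∈ X) (y : ZdEdge d) (hy : y ∈ X) : ‖e.1 - y.1‖ ≤ (1 : ℝ) := by
  obtain ⟨p, -, rfl⟩ := Finset.mem_image.1 hX
  exact norm_sub_le_one_of_mem_plaquetteEdges he hy

/-- Oscillation witnesses: every term oscillates by at most `|t|` in every link (it lies in
`[0, t]` or `[t, 0]`). -/
theorem isOscBound_adjointWitness (hN : 1 ≤ N) (t : ℝ) (X : Finset (ZdEdge d)) :
    Dobrushin.IsOscBound (adjointWitness (N := N) t X) fun _ => |t| := by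
  refine ⟨fun _ => abs_nonneg t, fun y U V _ => ?_⟩
  unfold adjointWitness
  split_ifs with h
  · set a := plaquetteObs (fundamentalRep (Fin N)) (Classical.choose h).1 (Classical.choose h).2.1.1
      (Classical.choose h).2.1.2 U / N
    set b := plaquetteObs (fundamentalRep (Fin N)) (Classical.choose h).1 (Classical.choose h).2.1.1
      (Classical.choose h).2.1.2 V / N
    have ha := abs_plaquetteObs_div_le_one hN (Classical.choose h) U
    have hb := abs_plaquetteObs_div_le_one hN (Classical.choose h) V
    have ha2 : a ^ 2 ≤ 1 := by
      have := (sq_le_one_iff_abs_le_one a).2 ha; exact this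
    have hb2 : b ^ 2 ≤ 1 := by
      have := (sq_le_one_iff_abs_le_one b).2 hb; exact this
    rw [← mul_sub, abs_mul]
    refine mul_le_of_le_one_right (abs_nonneg t) ?_
    rw [abs_le]; constructor <;> nlinarith [sq_nonneg a, sq_nonneg b]
  · simp

/-- Lipschitz witnesses: a term is `2|t|/√N`-Lipschitz in each of its own links and constant in every
other link. -/
theorem isLipBound_adjointWitness (hN : 1 ≤ N) (t : ℝ) (X : Finset (ZdEdge d)) :
    IsLipBound suFrobDist (adjointWitness (N := N) t X)
      fun y => if y ∈ X then 2 * |t| / Real.sqrt N else 0 := by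
  classical
  have hN0 : (0 : ℝ) < N := by exact_mod_cast hN
  have hsN : 0 < Real.sqrt N := Real.sqrt_pos.2 hN0
  refine ⟨fun y => by split_ifs <;> positivity, fun y U V hUV => ?_⟩
  by_cases hyX : y ∈ X
  · rw [if_pos hyX]
    unfold adjointWitness
    split_ifs with h
    · have hp := Classical.choose_spec h
      set p := Classical.choose h
      have hyp : y ∈ plaquetteEdges p := by rw [hp]; exact hyX
      set a := plaquetteObs (fundamentalRep (Fin N)) p.1 p.2.1.1 p.2.1.2 U / N with ha_def
      set b := plaquetteObs (fundamentalRep (Fin N)) p.1 p.2.1.1 p.2.1.2 V / N with hb_def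
      have ha := abs_plaquetteObs_div_le_one hN p U
      have hb := abs_plaquetteObs_div_le_one hN p V
      have hab : |a - b| ≤ suFrobDist (U y) (V y) / Real.sqrt N := by
        rw [ha_def, hb_def, ← sub_div, abs_div, abs_of_pos hN0, div_le_div_iff₀ hN0 hsN]
        calc |plaquetteObs (fundamentalRep (Fin N)) p.1 p.2.1.1 p.2.1.2 U -
              plaquetteObs (fundamentalRep (Fin N)) p.1 p.2.1.1 p.2.1.2 V| * Real.sqrt N
            ≤ Real.sqrt N * suFrobDist (U y) (V y) * Real.sqrt N :=
              mul_le_mul_of_nonneg_right (abs_plaquetteObs_sub_le_of_eq_off hyp hUV) hsN.le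
          _ = suFrobDist (U y) (V y) * N := by
              rw [mul_comm (Real.sqrt N), mul_assoc, Real.mul_self_sqrt hN0.le]
      calc |t * a ^ 2 - t * b ^ 2| = |t| * (|a + b| * |a - b|) := by
            rw [← mul_sub, abs_mul, sq_sub_sq, abs_mul]
        _ ≤ |t| * (2 * (suFrobDist (U y) (V y) / Real.sqrt N)) := by
            refine mul_le_mul_of_nonneg_left (mul_le_mul ((abs_add_le _ _).trans (by linarith)) hab
              (abs_nonneg _) zero_le_two) (abs_nonneg t)
        _ = 2 * |t| / Real.sqrt N * suFrobDist (U y) (V y) := by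
            field_simp
    · rw [sub_self, abs_zero]
      exact mul_nonneg (by positivity) (suFrobDist_nonneg _ _)
  · rw [if_neg hyX, zero_mul]
    have heq := dependsOn_adjointWitness (N := N) t X (fun e he => hUV e fun h => hyX (h ▸ Finset.mem_coe.1 he))
    rw [heq, sub_self, abs_zero]

/-- The number of listed plaquette link sets through a link is at most `2(d-1)`. -/
theorem card_plaquetteSupp_singleton_le (e : ZdEdge d) :
    ((plaquetteSupp {e}).filter fun X => e ∈ X).card ≤ 2 * (d - 1) :=
  ((Finset.card_filter_le _ _).trans Finset.card_image_le).trans (card_plaquettesTouching_singleton_le e)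

/-- **Oscillation load of the witness**: `∑_{X ∈ supp{e}, e ∈ X} |t| ≤ 2(d-1)|t|`. -/
theorem oscLoad_adjointWitness_le (hd : 1 ≤ d) (t : ℝ) (e : ZdEdge d) :
    ∑ X ∈ (plaquetteSupp {e}).filter (fun X => e ∈ X), (fun (_ : Finset (ZdEdge d)) (_ : ZdEdge d) => |t|) X e ≤
      2 * ((d : ℝ) - 1) * |t| := by
  rw [Finset.sum_const, nsmul_eq_mul]
  have h := card_plaquetteSupp_singleton_le (d := d) e
  have hcast : ((((plaquetteSupp {e}).filter fun X => e ∈ X).card : ℕ) : ℝ) ≤ 2 * ((d : ℝ) - 1) := by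
    calc ((((plaquetteSupp {e}).filter fun X => e ∈ X).card : ℕ) : ℝ) ≤ ((2 * (d - 1) : ℕ) : ℝ) := by
          exact_mod_cast h
      _ = 2 * ((d : ℝ) - 1) := by push_cast [Nat.cast_sub hd]; ring
  exact mul_le_mul_of_nonneg_right hcast (abs_nonneg t)

/-- **Cross-Lipschitz load of the witness**: `∑_{y ∈ range} ∑_{X ∈ supp{e}, e ∈ X} lip X y ≤ 16(d-1)|t|/√N`
(each of the `≤ 2(d-1)` plaquette link sets through `e` has `≤ 4` links, each carrying `2|t|/√N`). -/
theorem crossLoad_adjointWitness_le (hd : 1 ≤ d) (t : ℝ) (e : ZdEdge d) :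
    ∑ y ∈ perturbedNbr plaquetteSupp e, ∑ X ∈ (plaquetteSupp {e}).filter (fun X => e ∈ X),
        (fun (X : Finset (ZdEdge d)) (y : ZdEdge d) => if y ∈ X then 2 * |t| / Real.sqrt N else 0) X y ≤
      16 * ((d : ℝ) - 1) * |t| / Real.sqrt N := by
  classical
  rw [Finset.sum_comm]
  have hc0 : 0 ≤ 2 * |t| / Real.sqrt N := by positivity
  have hX : ∀ X ∈ (plaquetteSupp {e}).filter (fun X => e ∈ X),
      ∑ y ∈ perturbedNbr plaquetteSupp e, (if y ∈ X then 2 * |t| / Real.sqrt N else 0) ≤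
        4 * (2 * |t| / Real.sqrt N) := by
    intro X hXm
    obtain ⟨p, -, hp⟩ := Finset.mem_image.1 (Finset.mem_filter.1 hXm).1
    rw [← Finset.sum_filter, Finset.sum_const, nsmul_eq_mul]
    refine mul_le_mul_of_nonneg_right ?_ hc0
    have h1 : ((perturbedNbr plaquetteSupp e).filter fun y => y ∈ X).card ≤ X.card :=
      Finset.card_le_card fun y hy => (Finset.mem_filter.1 hy).2
    have h2 : X.card ≤ 4 := hp ▸ card_plaquetteEdges_le p
    exact_mod_cast h1.trans h2
  refine (Finset.sum_le_sum hX).trans ?_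
  rw [Finset.sum_const, nsmul_eq_mul]
  have h := card_plaquetteSupp_singleton_le (d := d) e
  have hcast : ((((plaquetteSupp {e}).filter fun X => e ∈ X).card : ℕ) : ℝ) ≤ 2 * ((d : ℝ) - 1) := by
    calc ((((plaquetteSupp {e}).filter fun X => e ∈ X).card : ℕ) : ℝ) ≤ ((2 * (d - 1) : ℕ) : ℝ) := by
          exact_mod_cast h
      _ = 2 * ((d : ℝ) - 1) := by push_cast [Nat.cast_sub hd]; ring
  calc ((((plaquetteSupp {e}).filter fun X => e ∈ X).card : ℕ) : ℝ) * (4 * (2 * |t| / Real.sqrt N))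
      ≤ 2 * ((d : ℝ) - 1) * (4 * (2 * |t| / Real.sqrt N)) := mul_le_mul_of_nonneg_right hcast (by positivity)
    _ = 16 * ((d : ℝ) - 1) * |t| / Real.sqrt N := by ring

/-- **The adjoint witness is a member of the `ℤ^d` ball** `MemBallZd (2(d-1)|t|) (16(d-1)|t|/√N) 1` for
every `t` (referee test T0.2: a non-Wilson member with its loads computed). -/
theorem memBallZd_adjointWitness (hd : 1 ≤ d) (hN : 1 ≤ N) (t : ℝ) :
    MemBallZd (2 * ((d : ℝ) - 1) * |t|) (16 * ((d : ℝ) - 1) * |t| / Real.sqrt N) 1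
      (adjointWitness (d := d) (N := N) t) plaquetteSupp where
  continuous := continuous_adjointWitness t
  dependsOn := dependsOn_adjointWitness t
  supportedBy := isSupportedBy_adjointWitness t
  range := range_adjointWitness
  loads := ⟨fun _ _ => |t|, fun X y => if y ∈ X then 2 * |t| / Real.sqrt N else 0,
    isOscBound_adjointWitness hN t, isLipBound_adjointWitness hN t, oscLoad_adjointWitness_le hd t,
    crossLoad_adjointWitness_le hd t⟩

/-! ### A certified mixed-action row: `SU(2)`, `d = 4`, `β_W = 1/8`, `|t| ≤ 1/100` -/

/-- `√2 ≥ 1.41421`, i.e. `1/√2 ≤ 1/1.41421`. -/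
theorem sqrt_two_ge : (141421 / 100000 : ℝ) ≤ Real.sqrt 2 :=
  Real.le_sqrt_of_sq_le (by norm_num)

/-- **THE MIXED FUNDAMENTAL–ADJOINT `SU(2)` ACTION HAS A MASS GAP at `β_W = 1/8`, `|t| ≤ 1/100`**
(lattice `ℤ⁴`, 't Hooft `β = 1/32`): the action `(β_W/2) Σ_p Re tr U_p`-Wilson part plus
`t Σ_p (Re tr U_p/2)²` has exactly one DLR state, exponentially clustering — the ball theorem
`su2_massGapOnBallZd_sharp` at the member `adjointWitness t` (loads `a ≤ 6|t|`, `Λ ≤ 48|t|/√2`, range 1):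
`3√3/8 · e^{6|t|} + e^{3|t|} √(2/3) · 48|t|/√2 ≤ 0.976 < 1` at `|t| = 1/100`, in exact arithmetic. The row
rests on lineage (B), i.e. on the sharp `SU(2)` linear variance `su2_linVariance_sharp` (`v = 2`,
valid since `β_W = 1/8 ≤ 1/6`); through the Poincaré pair (A) alone the same member gives a row sum
`> 1` (rb-theory, `HOME/rb/certs/rb_rows.md`, «Named rows»). -/
theorem su2_mixedAction_massGap_1_8 {t : ℝ} (ht : |t| ≤ 1 / 100) :
    PerturbedMassGapAt 4 2 ((1 / 8 : ℝ) / 4) (adjointWitness t) plaquetteSupp := by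
  have hmem := memBallZd_adjointWitness (d := 4) (N := 2) (by norm_num) (by norm_num) t
  have h3 : (2 : ℝ) * (((4 : ℕ) : ℝ) - 1) = 6 := by norm_num
  have h16 : (16 : ℝ) * (((4 : ℕ) : ℝ) - 1) = 48 := by norm_num
  rw [h3, h16] at hmem
  refine su2_massGapOnBallZd_sharp (βW := 1 / 8) (ε₀ := 6 * |t|) (ε₁ := 48 * |t| / Real.sqrt ((2 : ℕ) : ℝ))
    1 (by norm_num) ?_ _ _ hmem
  have ht0 : 0 ≤ |t| := abs_nonneg t
  have h1 := exp_le_taylor4 (x := 6 * |t|) (by positivity) (by linarith)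
  have h2 := exp_le_taylor4 (x := 3 * |t|) (by positivity) (by linarith)
  have hs2 : Real.sqrt ((2 : ℕ) : ℝ) = Real.sqrt 2 := by norm_num
  rw [hs2, show 6 * |t| / 2 = 3 * |t| by ring, abs_of_pos (by norm_num : (0 : ℝ) < 1 / 8)]
  have hinv : 48 * |t| / Real.sqrt 2 ≤ 48 * |t| / (141421 / 100000) :=
    div_le_div_of_nonneg_left (by positivity) (by norm_num) sqrt_two_ge
  calc 3 * Real.sqrt 3 * (1 / 8) * exp (6 * |t|) + exp (3 * |t|) * Real.sqrt (2 / 3) * (48 * |t| / Real.sqrt 2)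
      ≤ 3 * (1732051 / 1000000) * (1 / 8) *
          (1 + 6 * |t| + (6 * |t|) ^ 2 / 2 + (6 * |t|) ^ 3 / 6 + 5 / 96 * (6 * |t|) ^ 4) +
        (1 + 3 * |t| + (3 * |t|) ^ 2 / 2 + (3 * |t|) ^ 3 / 6 + 5 / 96 * (3 * |t|) ^ 4) *
          (8165 / 10000) * (48 * |t| / (141421 / 100000)) := by
        gcongr
        · exact sqrt_three_le_bound
        · exact sqrt_two_thirds_le
    _ ≤ 3 * (1732051 / 1000000) * (1 / 8) *
          (1 + 6 * (1 / 100 : ℝ) + (6 * (1 / 100 : ℝ)) ^ 2 / 2 + (6 * (1 / 100 : ℝ)) ^ 3 / 6 +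
            5 / 96 * (6 * (1 / 100 : ℝ)) ^ 4) +
        (1 + 3 * (1 / 100 : ℝ) + (3 * (1 / 100 : ℝ)) ^ 2 / 2 + (3 * (1 / 100 : ℝ)) ^ 3 / 6 +
            5 / 96 * (3 * (1 / 100 : ℝ)) ^ 4) *
          (8165 / 10000) * (48 * (1 / 100 : ℝ) / (141421 / 100000)) := by
        gcongr
    _ < 1 := by norm_num

end Summit.Ventures.YMGap.RobustBall
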